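import Summits.Langlands.Langlands.Theses.QuarterDeficit1951

/-!
Ideator sketch — crux `CensusDecoding` (stmt-Langlands-17935), round 1, ideator 2.

Crux (route `QuarterDeficit1951`, rank 5, decoding glue):

  `CensusDecoding := CensusDeficit1951 → WindowFormDictionary → QuarterFingerprintDeficit`.

Card `pointwise-decoding-transfer`: the lever is Decoding Theorem I
`Literature.NumberTheory.Automorphic.MaassHeckeTraceCensus.not_fingerprinted`, reached through a
LET-FREE, level-generic POINTWISE decoding lemma (`no_fingerprinted_window_form`, the card's
"First lemma" = transfer form C⁺), of which the crux is the `N = 1951`, `w = t = 1/100`,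
`P = {2,3,5,7,11,13}` instance composed with the dictionary item.  Both theorems below are
intended to be sorry-free; `censusDecoding` has literally the type of the route decl.
-/

set_option linter.dupNamespace false

open Literature.NumberTheory.Automorphic

namespace Summit.Langlands.Langlands.Cruxes.CensusDecoding.IdeatorSketch2

open Summit.Langlands.Langlands.Theses.QuarterDeficit1951

/-- **First lemma (C⁺, pointwise decoding, level-generic, let-free).**  For ANY level `N`,
character `χ`, transcript `c` that is a certified census with the deficit verdict, any window
radius `w ≤ c.window`, tolerance `t ≤ c.fpTol` and any finite set `P` of PRIMES containing the
transcript's fingerprint primes: there is no non-zero weight-`0` Maass cusp form on `(Γ₀(N), χ)`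
with `|λ - 1/4| ≤ w` which at every `p ∈ P` is a pointwise eigenfunction of the INLINED prime Hecke
operator `p^{-1/2}(Σ_{b<p} u((z+b)/p) + χ(p) u(pz))` with eigenvalue `μ_p` whose fingerprint
quantity `μ_p² · conj χ(p)` is within `t` of the icosahedral set `Φ`.  Proof: `maassHeckeOp_prime`
turns the pointwise relations into `maassHeckeOp N χ p u = μ p • u` on `c.fpPrimes ⊆ P`, and
`not_fingerprinted` produces a prime where the fingerprint is violated by more than `fpTol ≥ t`. -/
theorem no_fingerprinted_window_form {N : ℕ} {χ : DirichletCharacter ℂ N}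
    {c : MaassHeckeTraceCensus} (hc : CertifiedMaassHeckeTraceCensus N χ c)
    (hv : c.certifiesDeficit = true) {w t : ℝ} (hw : w ≤ (c.window : ℝ)) (ht : t ≤ (c.fpTol : ℝ))
    {P : Finset ℕ} (hP : ∀ p ∈ c.fpPrimes, p ∈ P) (hPprime : ∀ p ∈ P, p.Prime)
    {u : UpperHalfPlane → ℂ} {lam : ℝ} (hu : IsMaassCuspFormOn N χ u lam) (hne : ∃ z, u z ≠ 0)
    (hwin : |lam - 1 / 4| ≤ w)
    (hfp : ∀ p ∈ P, ∃ μ φ : ℂ, φ ∈ icosahedralFingerprint ∧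
      (∀ z : UpperHalfPlane, ((Real.sqrt p : ℝ) : ℂ)⁻¹ *
          ((∑ b ∈ Finset.range p, u (UpperHalfPlane.ofComplex (((z : ℂ) + b) / p))) +
            χ (p : ZMod N) * u (UpperHalfPlane.ofComplex ((p : ℂ) * z))) = μ * u z) ∧
      ‖μ ^ 2 * (starRingEnd ℂ) (χ (p : ZMod N)) - φ‖ ≤ t) :
    False := by
  classical
  choose! μ φ hΦ hT hdist using hfp
  have hT' : ∀ p ∈ c.fpPrimes, maassHeckeOp N χ p u = μ p • u := by
    intro p hp
    funext z
    rw [Pi.smul_apply, smul_eq_mul, maassHeckeOp_prime N χ (hPprime p (hP p hp)) u z]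
    exact hT p (hP p hp) z
  obtain ⟨p, hp, hviol⟩ :=
    MaassHeckeTraceCensus.not_fingerprinted hc hv hu hne (hwin.trans hw) hT'
  have h1 := hviol (φ p) (hΦ p (hP p hp))
  have h2 := hdist p (hP p hp)
  linarith

/-- **The crux, by name.**  `CensusDeficit1951 → WindowFormDictionary → QuarterFingerprintDeficit`:
per order-`5` character, fetch the certified deficit transcript, upgrade the route's inlined
Maass-form predicate to `IsMaassCuspFormOn 1951 χ u λ` with the dictionary item, and apply the
pointwise decoding lemma with `w = t = 1/100`, `P = {2,3,5,7,11,13}` (the route's `Φ` is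
`icosahedralFingerprint` verbatim and its `Tp` is the right-hand side of `maassHeckeOp_prime`). -/
theorem censusDecoding : CensusDecoding := by
  intro hcensus hdict
  show QuarterFingerprintDeficit
  -- `intro` on the folded constant whnf-exposes the binders, zeta-reducing the four `let`s
  -- (Φ, P₀, IsForm, Tp become beta-redexes in the hypothesis); clean them with `beta_reduce`.
  intro χ hχ hex
  beta_reduce at hex
  obtain ⟨u, lam, ⟨hC2, heig, hslash, hcusp1, hcusp0, hbdd⟩, hne, hwin, hfp⟩ := hex
  obtain ⟨c, hw, ht, hprimes, hcert, hverdict⟩ := hcensus χ hχ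
  have hu : IsMaassCuspFormOn 1951 χ u lam := hdict χ u lam hC2 heig hslash hcusp1 hcusp0 hbdd
  have hPprime : ∀ p ∈ ({2, 3, 5, 7, 11, 13} : Finset ℕ), p.Prime := by
    intro p hp
    simp only [Finset.mem_insert, Finset.mem_singleton] at hp
    rcases hp with rfl | rfl | rfl | rfl | rfl | rfl <;> norm_num
  have hw' : (1 / 100 : ℝ) ≤ (c.window : ℝ) := by
    have h := (Rat.cast_le (K := ℝ)).mpr hw; push_cast at h; exact h
  have ht' : (1 / 100 : ℝ) ≤ (c.fpTol : ℝ) := by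
    have h := (Rat.cast_le (K := ℝ)).mpr ht; push_cast at h; exact h
  exact no_fingerprinted_window_form hcert hverdict hw' ht' hprimes hPprime hu hne hwin
    (fun p hp => hfp p hp)

end Summit.Langlands.Langlands.Cruxes.CensusDecoding.IdeatorSketch2
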